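import Summits.Ventures.LatticeQCDFlow.Exactness.IMHModeHolding
import HarnessLib

/-!
# The hot start moves: from a fresh model draw the first flow-MCMC step is accepted with probability at least
# one half, whatever the model

HONEST FRAMING: exact (Metropolis-corrected) sampling algorithms for lattice gauge theory;
figures of merit are autocorrelation/cost numbers at stated couplings and volumes; no
continuum-physics claim.

Venture `LatticeQCDFlow` (cell pub-lqcd), topic `Exactness`; FANOUT row 30 (lean-1, GEN-31).  NEW WORK of the
cell, general state space.  This generation's cold-start files show that from the MODE of the weight an exact
(independence Metropolis / flow-MCMC) sampler `K = indepMH q w` is frozen for `w(x₀) = 1/A(x₀)` steps.  The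
practitioner's start is not the mode but a FRESH MODEL DRAW `X₀ ∼ q` (the "hot start").  Its first step is
cheap to analyse and behaves oppositely:

* §1 **`one_le_imhAcceptE_add`** — for every pair of states one of the two moves `x → y`, `y → x` is uphill and
  hence always accepted: `a(x, y) + a(y, x) ≥ 1` (and `≤ 2`, **`imhAcceptE_add_le_two`**).
* §2 **`one_le_two_mul_lintegral_imhAcceptMass`** — integrating over `q ⊗ q` and swapping (Tonelli):
  `∫ A dq ≥ 1/2` — THE MODEL-AVERAGED ACCEPTANCE IS AT LEAST ONE HALF FOR EVERY PROPOSAL `q` AND EVERY WEIGHT `w`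
  (no normalisation, no boundedness, no atom hypothesis); real form **`half_le_integral_imhAcceptMass`**.
* §3 **`half_le_lintegral_hotStart_move`** — if `q` has no atoms, the hot-started chain LEAVES its initial state
  at the first step with probability `∫ K(x, {x}ᶜ) q(dx) = ∫ A dq ≥ 1/2`.

Reading: for both exact gauge samplers of `Scaling/AutoregressiveGauge…` the hot start is one draw of the exact
autoregression; its first Metropolis step is accepted with probability `≥ 1/2` at every coupling, volume and
dimension — while the cold start is frozen for `c^{#B}M^k/Z` steps (exponential in `L³` along optimal structures
in `d = 3`).  NOT CLAIMED: anything about the SECOND step or about mixing from the hot start (the accepted state is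
not `π`-distributed; the equilibrium acceptance `∫ A dπ` can be far below `1/2`).

No `sorry`, no new definitions, nothing cited as a fact.
-/

noncomputable section

namespace Summit.Ventures.LatticeQCDFlow.Exactness

open MeasureTheory ProbabilityTheory Function
open scoped ENNReal

variable {Ω : Type*} [MeasurableSpace Ω]
variable {q : Measure Ω} [IsProbabilityMeasure q] {w : Ω → ℝ}

/-! ## §1 Of two opposite moves one is uphill -/

omit [MeasurableSpace Ω] [IsProbabilityMeasure q] in
/-- **`a(x, y) + a(y, x) ≥ 1`**: of the two moves `x → y` and `y → x` one is uphill and always accepted. [ours] -/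
theorem one_le_imhAcceptE_add (hw0 : ∀ y, 0 < w y) (x y : Ω) : 1 ≤ imhAcceptE w x y + imhAcceptE w y x := by
  unfold imhAcceptE imhAccept
  by_cases hxy : w y ≤ w x
  · have h1 : min 1 (w x / w y) = 1 := min_eq_left ((one_le_div (hw0 y)).2 hxy)
    rw [h1, ENNReal.ofReal_one]
    exact le_add_self
  · have h1 : min 1 (w y / w x) = 1 := min_eq_left ((one_le_div (hw0 x)).2 (not_le.1 hxy).le)
    rw [h1, ENNReal.ofReal_one]
    exact le_self_add

omit [MeasurableSpace Ω] [IsProbabilityMeasure q] in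
/-- `a(x, y) + a(y, x) ≤ 2`. [ours] -/
theorem imhAcceptE_add_le_two (x y : Ω) : imhAcceptE w x y + imhAcceptE w y x ≤ 2 := by
  calc imhAcceptE w x y + imhAcceptE w y x ≤ 1 + 1 := add_le_add (imhAcceptE_le_one w x y) (imhAcceptE_le_one w y x)
    _ = 2 := one_add_one_eq_two

/-! ## §2 The model-averaged acceptance is at least one half -/

omit [IsProbabilityMeasure q] in
/-- Tonelli swap of the double acceptance integral: `∫∫ a(x, y) q(dy) q(dx) = ∫∫ a(y, x) q(dy) q(dx)`. [ours] -/
theorem lintegral_lintegral_imhAcceptE_swap (hw : Measurable w) [SFinite q] :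
    ∫⁻ x, ∫⁻ y, imhAcceptE w x y ∂q ∂q = ∫⁻ x, ∫⁻ y, imhAcceptE w y x ∂q ∂q :=
  lintegral_lintegral_swap ((measurable_imhAcceptE hw).aemeasurable (μ := q.prod q))

/-- **`2·∫ A dq ≥ 1`: THE MODEL-AVERAGED ACCEPTANCE OF FLOW-MCMC IS AT LEAST ONE HALF**, for every proposal `q` and
every measurable positive weight `w`. [ours] -/
theorem one_le_two_mul_lintegral_imhAcceptMass (hw : Measurable w) (hw0 : ∀ y, 0 < w y) :
    1 ≤ 2 * ∫⁻ x, imhAcceptMass q w x ∂q := by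
  unfold imhAcceptMass
  have hm : Measurable fun x => ∫⁻ y, imhAcceptE w x y ∂q := (measurable_imhAcceptE hw).lintegral_prod_right'
  have hm' : ∀ x, Measurable fun y => imhAcceptE w x y := fun x => (measurable_imhAcceptE hw).of_uncurry_left
  calc (1 : ℝ≥0∞) = ∫⁻ _x, ∫⁻ _y, 1 ∂q ∂q := by simp
    _ ≤ ∫⁻ x, ∫⁻ y, (imhAcceptE w x y + imhAcceptE w y x) ∂q ∂q :=
        lintegral_mono fun x => lintegral_mono fun y => one_le_imhAcceptE_add hw0 x y
    _ = ∫⁻ x, ∫⁻ y, imhAcceptE w x y ∂q ∂q + ∫⁻ x, ∫⁻ y, imhAcceptE w y x ∂q ∂q := by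
        rw [← lintegral_add_left hm]
        refine lintegral_congr fun x => ?_
        rw [lintegral_add_left (hm' x)]
    _ = 2 * ∫⁻ x, ∫⁻ y, imhAcceptE w x y ∂q ∂q := by
        rw [← lintegral_lintegral_imhAcceptE_swap hw, two_mul]

/-- **Real form: `∫ A dq ≥ 1/2`.** [ours] -/
theorem half_le_integral_imhAcceptMass (hw : Measurable w) (hw0 : ∀ y, 0 < w y) :
    1 / 2 ≤ ∫ x, (imhAcceptMass q w x).toReal ∂q := by
  have hA1 : ∀ x, imhAcceptMass q w x ≤ 1 := fun x => imhAcceptMass_le_one q w x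
  have hmeas : Measurable (imhAcceptMass q w) := measurable_imhAcceptMass q hw
  have hint : ∫ x, (imhAcceptMass q w x).toReal ∂q = (∫⁻ x, imhAcceptMass q w x ∂q).toReal := by
    rw [integral_toReal hmeas.aemeasurable (ae_of_all _ fun x => (hA1 x).trans_lt ENNReal.one_lt_top)]
  have hfin : ∫⁻ x, imhAcceptMass q w x ∂q ≠ ⊤ := by
    refine ne_top_of_le_ne_top ENNReal.one_ne_top ?_
    calc ∫⁻ x, imhAcceptMass q w x ∂q ≤ ∫⁻ _x, 1 ∂q := lintegral_mono fun x => hA1 x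
      _ = 1 := by simp
  have h := one_le_two_mul_lintegral_imhAcceptMass (q := q) hw hw0
  rw [hint]
  have h2 : (1 : ℝ≥0∞).toReal ≤ (2 * ∫⁻ x, imhAcceptMass q w x ∂q).toReal :=
    ENNReal.toReal_mono (ENNReal.mul_ne_top ENNReal.ofNat_ne_top hfin) h
  rw [ENNReal.toReal_one, ENNReal.toReal_mul, ENNReal.toReal_ofNat] at h2
  linarith

/-! ## §3 The hot-started chain leaves its initial state at once with probability at least one half -/

/-- For an atom-free proposal the one-step probability of leaving `x` is the acceptance mass: `K(x, {x}ᶜ) = A(x)`.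
[ours] -/
theorem indepMH_apply_compl_singleton [MeasurableSingletonClass Ω] (hw : Measurable w) {x : Ω} (hqx : q {x} = 0) :
    indepMH q w x {x}ᶜ = imhAcceptMass q w x := by
  haveI : Fact (Measurable w) := ⟨hw⟩
  have h1 : indepMH q w x {x}ᶜ + indepMH q w x {x} = 1 := by
    rw [add_comm, measure_add_measure_compl (measurableSet_singleton x), measure_univ]
  have h2 : indepMH q w x {x} = 1 - imhAcceptMass q w x := indepMH_apply_singleton_eq hw hqx
  have hA1 : imhAcceptMass q w x ≤ 1 := imhAcceptMass_le_one q w x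
  have hfin : indepMH q w x {x} ≠ ⊤ := measure_ne_top _ _
  calc indepMH q w x {x}ᶜ = 1 - indepMH q w x {x} := by
        rw [← h1, ENNReal.add_sub_cancel_right hfin]
    _ = imhAcceptMass q w x := by
        rw [h2, ENNReal.sub_sub_cancel ENNReal.one_ne_top hA1]

/-- **THE HOT START MOVES**: for an atom-free proposal (`q{x} = 0` for all `x`), the chain started from a fresh
model draw leaves its initial state at the first step with probability `∫ K(x, {x}ᶜ) q(dx) ≥ 1/2`. [ours] -/
theorem half_le_lintegral_hotStart_move [MeasurableSingletonClass Ω] (hw : Measurable w) (hw0 : ∀ y, 0 < w y)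
    (hq : ∀ x, q {x} = 0) : 1 ≤ 2 * ∫⁻ x, indepMH q w x {x}ᶜ ∂q := by
  simp_rw [indepMH_apply_compl_singleton hw (hq _)]
  exact one_le_two_mul_lintegral_imhAcceptMass hw hw0

end Summit.Ventures.LatticeQCDFlow.Exactness
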